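import Summits.FinalStateConjecture.FinalStateConjecture.Theses.PhaseMixingCapture
import Literature.Geometry.Lorentzian.TameGenericityLocalWindow
import Literature.Geometry.Lorentzian.DataFamilyTangentKernelManifold
import Literature.Geometry.Lorentzian.IsometryProofs

/-!
# Line `slide-and-kick` — crux `CaptureSufficesTame` (stmt-FinalStateConjecture-17270,
# route PhaseMixingCapture, rank 6) — skeleton v1 (crux-plan seat, 2026-08-17)

Crux (FIXED, concluded BY NAME in `CaptureSufficesTame_of`):
`PhaseMixingCapture.CaptureSufficesTame := NearExtremalKappaCapture → BulkKerrCaptureC2 →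
WeakCosmicCensorshipTame → FinalStateConjecture`.

Card `slide-and-kick` (ideator 1; triage r1: pass ×2, "host/bookkeeping layer, plan with the late-slice
transfer as first landable geometric stub; slide := breathing, not time translation"). The lever: the
summit's tame genericity notion asks the witness curve to be IMMERSED at `c = 0` (a first-jet condition,
`InitialDataSet.IsImmersedAtZero`), not transverse to the exceptional set; so a witness may SLIDE along a
free tame immersed curve (the breathing curve of the datum, or the censorship witness `h₃` hands over) and
ESCAPE one-sidedly and to second order by a KICK — the witness is the parabola `c ↦ H (c, c²)` of a
two-parameter family `H`; immersion and local injectivity come from the slide, escape from the kick.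
The kicks are designed LATE, on a lens-shaped Cauchy leaf of the maximal development where the geometry
is known, and pulled back to `t = 0` by time-reversed Cauchy stability; the summit matrix descends from
the kicked late leaf to the initial leaf.

## What is PROVED here (the host, §1–§2; no `sorry`)
* `contDiffAt_bilin_family`, `contDiff_h_inner_family`, `contDiff_k_family` — the scalar components
  `c ↦ h_c(x)(u,w)`, `c ↦ k_c(x)(u,w)` of a jointly smooth `m`-parameter family of data are `C^∞`
  (read the section at the fixed base point through the trivialisation, `contMDiffAt_bilin_iff`).
* `exists_window_injective` — an IMMERSED smooth curve of data is injective on a parameter window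
  (a scalar component is strictly monotone near `0`): injectivity is free, never a stub.
* `isImmersedAtZero_parab`, `slideImmersed_of_eqOn` — immersion of the parabola from immersion along the
  slide axis; immersion along the slide axis from agreement of the slide with an immersed curve.
* `isTameChristodoulouGeneric_of_slideKick` — composition of tame genericities along curves in
  SLIDE-AND-KICK form (window-local: `InitialDataSet.isTameChristodoulouGeneric_of_localWindow`): `P` is
  tame-generic as soon as, along every tame admissible curve with `Q`-members off `0` (told immersed-
  injective, or constant) whose base datum fails `P`, someone hands a two-parameter family `H` through
  the base, immersed along the slide axis, whose PARABOLA `c ↦ H (c, c²)` is tame, admissible on a window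
  and satisfies `P` on the punctured window. Only the parabola is constrained (typing repair of the card:
  demanding all members `(c, s)`, `s > 0`, would force kicks of the naked base datum itself in the
  relative regime, and global two-parameter tameness fails when kick footprints grow as `c → 0`).

## Registered stubs (the only `sorry`s; 4 ≤ stubs_max 7), all quantifying over maximal developments
* `stub_lateLeafTransfer` (S1, geometry, the first landable stub): the summit matrix DESCENDS from the
  data of a LENS leaf (a late Cauchy leaf of an MGHD agreeing with the initial leaf and its normal off a
  compact set) to the initial datum — maximality bookkeeping (MGHD uniqueness, landed), sojourn-form
  completeness (identical far rays), `exteriorOf` / `RaysStayInClosure` / `HasExhaustiveCharts` re-based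
  from `j(X)` to `ι(X)` (compact lens region; trimming `τ₀`). Lens leaves — not arbitrary late Cauchy
  slices — so that no blue-shift / asymptotic-position hypothesis is needed (typing repair).
* `stub_kickTransportSlide` (S2, PDE folklore + CBG): a jointly smooth compactly supported vacuum kick
  family `G` of the data of a lens leaf of an MGHD of an admissible datum `d` is realised at `t = 0`:
  there is a two-parameter family `H` with `H 0 = d`, immersed along the slide axis (slide := the
  breathing curve of `d`, `TameBreathingCurve.lean`, supported far from the kick's `t = 0` footprint),
  parabola tame and admissible on a window, and every parabola member off `0` has an MGHD carrying a lens
  leaf with the kicked data `G (c²)` (time-reversed Cauchy stability on the compact past of the kick,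
  domain of dependence off it, maximality via Choquet-Bruhat–Geroch). Honours triage T2 (slide is
  breathing, not time translation: the latter is not tame for `C²₋₁ × C¹₋₂` data).
* `stub_censoredLateKick` (S3, dynamics, C⁺ absolute): a CENSORED admissible datum failing the summit
  matrix admits, on some lens leaf of some MGHD, a compactly supported smooth vacuum kick family all of
  whose small POSITIVE members satisfy the summit matrix (as data of their own MGHDs). One-sided, late,
  local controllability: un-parking of extremal members at second order + black-hole-side capture;
  summit-hard on the non-quiet stratum (said plainly in the line card).
* `stub_nakedBaseKick` (S4, dynamics, C⁺ relative, HARDEST): along a tame immersed injective admissible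
  curve `F` of censored data whose base is NOT censored (the curve `h₃` hands through a naked datum), a
  jointly smooth two-parameter family `H` with `H (c, 0) = F c` whose parabola is tame and admissible on
  a window and whose parabola members off `0` have MGHDs carrying lens leaves with summit-good data
  (late kicks on the censored members, flat in `c` at `0`).

## Composition (§4, sorry-free)
`h₃ = WeakCosmicCensorshipTame` ⟹ (host, `Q :=` censored, `P :=` summit matrix) it suffices to serve
slide-and-kick families along censored curves with exceptional base: if the base is censored, S3 gives a
late kick family, S2 transports it to `t = 0` along the breathing slide, S1 certifies the parabola members;
if the base is naked the curve is immersed-injective and S4 serves the family, S1 certifies. Hence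
`FinalStateConjecture`, hence the crux (`h₁`, `h₂` introduced and dropped: idle as typed — Disproof.lean
§0–§1: modulo the captures the crux is `WCCTame ↔ FSC`, no `_false_without_` theorem exists; the card
pays this price knowingly, its kicks never read a Cauchy-leaf basin).
-/

-- the doubled `FinalStateConjecture.FinalStateConjecture` path component trips dupNamespace
set_option linter.dupNamespace false
set_option maxSynthPendingDepth 3

noncomputable section

open Bundle Set Function Filter
open scoped Manifold ContDiff Topology ENNReal

namespace Summit.FinalStateConjecture.FinalStateConjecture.Cruxes.CaptureSufficesTame.SlideAndKick

open Literature.Geometry.Lorentzian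
open Summit.FinalStateConjecture (HasCompleteNullInfinity exteriorOf RaysStayInClosure HasExhaustiveCharts
  IsFutureOriented)
open Summit.FinalStateConjecture.FinalStateConjecture.Theses.PhaseMixingCapture
  (NearExtremalKappaCapture BulkKerrCaptureC2 WeakCosmicCensorshipTame CaptureSufficesTame)

/-! ## §0 Vocabulary (unfoldable `def`s; the registered stubs of §3 use only these and tree declarations) -/

section Vocabulary

variable (X : Type) [TopologicalSpace X] [ChartedSpace E3 X] [IsManifold (𝓡 3) ∞ X]
  [T2Space X] [SecondCountableTopology X] [ConnectedSpace X]

/-- The matrix of the (re-typed, T2) summit at ONE datum `D`: verbatim the `fun D ↦ …` of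
`FinalStateConjecture`. -/
def SummitPropertyAt (D : InitialDataSet (𝓡 3) X) : Prop :=
  (∃ 𝒟 : VacuumCauchyDevelopment D, 𝒟.IsMaximal) ∧
    ∀ 𝒟 : VacuumCauchyDevelopment D, 𝒟.IsMaximal →
      HasCompleteNullInfinity 𝒟.toCauchyDevelopment ∧
        ∃ (O : Set 𝒟.carrier) (d : FinalStateDecomposition 𝒟.toSpacetime O 2),
          (∀ i, Kerr.IsSubextremal (d.mass i) (d.spin i)) ∧
            O = exteriorOf 𝒟.toCauchyDevelopment d.charted ∧
              RaysStayInClosure 𝒟.toCauchyDevelopment O ∧ HasExhaustiveCharts d ∧ IsFutureOriented d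

/-- The censorship matrix at one datum (the crux's hypothesis `h₃ = WeakCosmicCensorshipTame` is
VERBATIM its tame genericity): an MGHD exists and every MGHD has complete future null infinity. -/
def CensoredAt (D : InitialDataSet (𝓡 3) X) : Prop :=
  (∃ 𝒟 : VacuumCauchyDevelopment D, 𝒟.IsMaximal) ∧
    ∀ 𝒟 : VacuumCauchyDevelopment D, 𝒟.IsMaximal → HasCompleteNullInfinity 𝒟.toCauchyDevelopment

/-- Sanity: the summit is exactly the tame genericity of `SummitPropertyAt`, and `h₃` that of
`CensoredAt`. -/
theorem summit_iff : _root_.FinalStateConjecture ↔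
    ∀ (X : Type) [TopologicalSpace X] [ChartedSpace E3 X] [IsManifold (𝓡 3) ∞ X] [T2Space X]
      [SecondCountableTopology X] [ConnectedSpace X],
      InitialDataSet.IsTameChristodoulouGeneric (admissibleVacuumData X) (SummitPropertyAt X) 1 :=
  Iff.rfl

theorem censorship_iff : WeakCosmicCensorshipTame ↔
    ∀ (X : Type) [TopologicalSpace X] [ChartedSpace E3 X] [IsManifold (𝓡 3) ∞ X] [T2Space X]
      [SecondCountableTopology X] [ConnectedSpace X],
      InitialDataSet.IsTameChristodoulouGeneric (admissibleVacuumData X) (CensoredAt X) 1 :=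
  Iff.rfl

variable {X}

/-- **Lens leaf.** `(j, ν')` is a LATE LENS LEAF of the vacuum Cauchy development `𝒟 = (M, g, τ, ι, ν)`
of `D` carrying the data `D'`: a smooth embedding `j : X → M` with future unit normal `ν'` inducing
`D' = (j^* g, K_{ν'})`, whose image is a Cauchy hypersurface of `(M, g, τ)` lying in `J⁺(ι X)`, and
which AGREES WITH THE INITIAL LEAF OFF A COMPACT SET: `j x = ι x`, `ν' x = ν x` for `x ∉ K`. (So
`D' = D` off `K`; the leaf bulges to the future over `K` only — late in the central region, where the
kicks live, and untouched near spatial infinity, so that far null rays, the far sojourn clauses and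
the far chart asymptotics of the two leaves are literally the same.) -/
def IsLensLeaf {D : InitialDataSet (𝓡 3) X} (𝒟 : VacuumCauchyDevelopment D)
    (D' : InitialDataSet (𝓡 3) X) (j : X → 𝒟.carrier) (ν' : NormalField (𝓡 4) j) : Prop :=
  Manifold.IsSmoothEmbedding (𝓡 3) (𝓡 4) ∞ j ∧
  𝒟.metric.IsFutureUnitNormal (𝓡 3) 𝒟.timeOrientation j ν' ∧
  (∀ y : X, pullbackBilin (I := 𝓡 4) (I' := 𝓡 3) j 𝒟.metric.val y = D'.h.inner y) ∧
  (∀ [𝒟.metric.toPseudoRiemannianMetric.HasLeviCivita] (y : X),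
    𝒟.metric.toPseudoRiemannianMetric.secondFundamentalForm (𝓡 3) j ν' y = D'.kBilin y) ∧
  𝒟.metric.IsCauchyHypersurface 𝒟.timeOrientation (range j) ∧
  range j ⊆ 𝒟.metric.causalFuture 𝒟.timeOrientation (range 𝒟.embed) ∧
  ∃ K : Set X, IsCompact K ∧ ∀ x ∉ K, j x = 𝒟.embed x ∧ ν' x = 𝒟.normal x

omit [T2Space X] [SecondCountableTopology X] in
/-- Anti-vacuity of the typing: the initial leaf `(ι, ν)` itself is a lens leaf of `𝒟` carrying `D`
(bulge `K = ∅`; `ι X ⊆ J⁺(ι X)`). So a prover of the kick stubs may kick at `t = 0` if he wishes;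
"late" is an option the lens offers, not an obligation. -/
theorem isLensLeaf_self {D : InitialDataSet (𝓡 3) X} (𝒟 : VacuumCauchyDevelopment D) :
    IsLensLeaf 𝒟 D 𝒟.embed 𝒟.normal :=
  ⟨𝒟.isSmoothEmbedding, 𝒟.isFutureUnitNormal, 𝒟.induced_h, 𝒟.induced_k, 𝒟.isCauchyHypersurface,
    𝒟.metric.subset_causalFuture 𝒟.timeOrientation _, ∅, isCompact_empty, fun _ _ ↦ ⟨rfl, rfl⟩⟩

end Vocabulary

/-! ## §1 The slide axis, the parabola, immersion along the slide -/

section Parabola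

/-- The slide axis `c ↦ (c, 0)` as a continuous linear map `ℝ¹ →L ℝ²`. -/
def slideAxisL : EuclideanSpace ℝ (Fin 1) →L[ℝ] EuclideanSpace ℝ (Fin 2) :=
  (EuclideanSpace.proj (0 : Fin 1)).smulRight (EuclideanSpace.single (0 : Fin 2) (1 : ℝ))

@[simp] theorem slideAxisL_apply (v : EuclideanSpace ℝ (Fin 1)) :
    slideAxisL v = (v 0) • EuclideanSpace.single (0 : Fin 2) (1 : ℝ) := rfl

/-- The PARABOLA `c ↦ (c, c²)` in the slide–kick plane: the shape of every witness of this line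
(slide coordinate `c`, kick coordinate `c² ≥ 0`, `> 0` off `0`: one-sided, second-order escape). -/
def parab (c : EuclideanSpace ℝ (Fin 1)) : EuclideanSpace ℝ (Fin 2) :=
  slideAxisL c + (c 0 * c 0) • EuclideanSpace.single (1 : Fin 2) (1 : ℝ)

@[simp] theorem parab_zero : parab 0 = 0 := by
  simp [parab]

@[simp] theorem parab_apply_zero (c : EuclideanSpace ℝ (Fin 1)) : parab c 0 = c 0 := by
  simp [parab]

@[simp] theorem parab_apply_one (c : EuclideanSpace ℝ (Fin 1)) : parab c 1 = c 0 * c 0 := by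
  simp [parab]

theorem contDiff_parab : ContDiff ℝ ∞ parab := by
  have hc0 : ContDiff ℝ ∞ (fun c : EuclideanSpace ℝ (Fin 1) ↦ c 0) :=
    (EuclideanSpace.proj (0 : Fin 1) : EuclideanSpace ℝ (Fin 1) →L[ℝ] ℝ).contDiff
  unfold parab
  exact slideAxisL.contDiff.add ((hc0.mul hc0).smul contDiff_const)

/-- The parabola leaves `0` with velocity the slide axis: `d(parab)₀ v = slideAxisL v`. -/
theorem fderiv_parab_zero (v : EuclideanSpace ℝ (Fin 1)) :
    fderiv ℝ parab 0 v = slideAxisL v ∧ DifferentiableAt ℝ parab 0 := by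
  have ht : HasFDerivAt (fun c : EuclideanSpace ℝ (Fin 1) ↦ c 0)
      (EuclideanSpace.proj (0 : Fin 1) : EuclideanSpace ℝ (Fin 1) →L[ℝ] ℝ) 0 :=
    (EuclideanSpace.proj (0 : Fin 1) : EuclideanSpace ℝ (Fin 1) →L[ℝ] ℝ).hasFDerivAt
  have h : HasFDerivAt parab (slideAxisL +
      ((0 : EuclideanSpace ℝ (Fin 1)) 0 • (EuclideanSpace.proj (0 : Fin 1) : EuclideanSpace ℝ (Fin 1) →L[ℝ] ℝ) +
        (0 : EuclideanSpace ℝ (Fin 1)) 0 • (EuclideanSpace.proj (0 : Fin 1) : EuclideanSpace ℝ (Fin 1) →L[ℝ] ℝ)).smulRight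
        (EuclideanSpace.single (1 : Fin 2) (1 : ℝ))) 0 := by
    unfold parab
    exact slideAxisL.hasFDerivAt.add ((ht.mul ht).smul_const _)
  refine ⟨?_, h.differentiableAt⟩
  rw [h.fderiv]
  simp

/-- The norm of a vector of `ℝ¹` is the absolute value of its coordinate. -/
theorem norm_fin_one (v : EuclideanSpace ℝ (Fin 1)) : ‖v‖ = |v 0| := by
  rw [EuclideanSpace.norm_eq]
  simp [Real.sqrt_sq_eq_abs]

/-- A vector of `ℝ¹` is the `single` of its coordinate. -/
theorem single_apply_zero_fin_one (v : EuclideanSpace ℝ (Fin 1)) :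
    EuclideanSpace.single (0 : Fin 1) (v 0) = v := by
  ext i
  fin_cases i
  simp

theorem apply_zero_ne_zero {c : EuclideanSpace ℝ (Fin 1)} (hc : c ≠ 0) : c 0 ≠ 0 := by
  intro h
  apply hc
  rw [← single_apply_zero_fin_one c, h]
  simp

variable {X : Type} [TopologicalSpace X] [ChartedSpace E3 X] [IsManifold (𝓡 3) ∞ X]

/-- `H : ℝ² → data` is **immersed along the slide axis at `0`**: for every slide direction `v ≠ 0`
some scalar component `p ↦ h_{H p}(x)(u, w)` or `p ↦ k_{H p}(x)(u, w)` has non-zero derivative at `0`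
in the direction `(v, 0)` (this is what a tame immersed SLIDE `c ↦ H (c, 0)` supplies; the kick
direction is unconstrained). -/
def SlideImmersed (H : EuclideanSpace ℝ (Fin 2) → InitialDataSet (𝓡 3) X) : Prop :=
  ∀ v : EuclideanSpace ℝ (Fin 1), v ≠ 0 → ∃ (x : X) (u w : TangentSpace (𝓡 3) x),
    fderiv ℝ (fun p ↦ (H p).h.inner x u w) 0 (slideAxisL v) ≠ 0 ∨
      fderiv ℝ (fun p ↦ (H p).k x u w) 0 (slideAxisL v) ≠ 0

/-- **The parabola of a slide-immersed family is immersed at `0`** (chain rule: `d(parab)₀ = slideAxisL`,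
the kick coordinate `c²` having zero derivative; differentiability of the scalar component at `0` is
forced by the non-vanishing of its `fderiv`). -/
theorem isImmersedAtZero_parab {H : EuclideanSpace ℝ (Fin 2) → InitialDataSet (𝓡 3) X}
    (hs : SlideImmersed H) : InitialDataSet.IsImmersedAtZero 1 (fun c ↦ H (parab c)) := by
  intro v hv
  obtain ⟨x, u, w, huw⟩ := hs v hv
  refine ⟨x, u, w, ?_⟩
  have chain : ∀ g : EuclideanSpace ℝ (Fin 2) → ℝ, fderiv ℝ g 0 (slideAxisL v) ≠ 0 →
      fderiv ℝ (fun c ↦ g (parab c)) 0 v ≠ 0 := by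
    intro g hg
    have hgd : DifferentiableAt ℝ g (parab 0) := by
      rw [parab_zero]
      by_contra hnd
      rw [fderiv_zero_of_not_differentiableAt hnd] at hg
      exact hg rfl
    have hc : fderiv ℝ (fun c ↦ g (parab c)) 0 = (fderiv ℝ g (parab 0)).comp (fderiv ℝ parab 0) :=
      fderiv_comp 0 hgd (fderiv_parab_zero v).2
    rw [hc, ContinuousLinearMap.comp_apply, (fderiv_parab_zero v).1, parab_zero]
    exact hg
  rcases huw with h | h
  · exact Or.inl (chain (fun p ↦ (H p).h.inner x u w) h)
  · exact Or.inr (chain (fun p ↦ (H p).k x u w) h)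

end Parabola

/-! ## §2 The host: scalar components are smooth, immersed ⇒ window-injective, the composition -/

section Host

variable {X : Type} [TopologicalSpace X] [ChartedSpace E3 X] [IsManifold (𝓡 3) ∞ X]

/-- **A jointly smooth family of bilinear-form sections is `C^∞` in the parameter, fibre by fibre**:
for `σ` jointly smooth into `Hom(TX, Hom(TX, ℝ))` and `x : X`, the map `c ↦ σ c x` of forms on
`T_x X = E3` is `C^∞` (read the section at the fixed base point `x` through the trivialisation at `x`,
`contMDiffAt_bilin_iff`, and undo the — invertible — trivialisation; the `m`-parameter version of
`InitialDataSet.differentiableAt_bilin_line`). [folklore] -/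
theorem contDiffAt_bilin_family {m : ℕ}
    {σ : EuclideanSpace ℝ (Fin m) → Π x : X, TangentSpace (𝓡 3) x →L[ℝ] TangentSpace (𝓡 3) x →L[ℝ] ℝ}
    (hσ : ContMDiff (𝓘(ℝ, EuclideanSpace ℝ (Fin m)).prod (𝓡 3)) ((𝓡 3).prod 𝓘(ℝ, E3 →L[ℝ] E3 →L[ℝ] ℝ)) ∞
      (fun p : EuclideanSpace ℝ (Fin m) × X ↦ TotalSpace.mk' (E3 →L[ℝ] E3 →L[ℝ] ℝ)
        (E := fun x : X ↦ TangentSpace (𝓡 3) x →L[ℝ] TangentSpace (𝓡 3) x →L[ℝ] ℝ) p.2 (σ p.1 p.2)))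
    (x : X) (c₀ : EuclideanSpace ℝ (Fin m)) :
    ContDiffAt ℝ ∞ (fun c : EuclideanSpace ℝ (Fin m) ↦ (show E3 →L[ℝ] E3 →L[ℝ] ℝ from σ c x)) c₀ := by
  -- the section along `c ↦ (c, x)` at the fixed base point `x`
  have h0 : ContMDiffAt 𝓘(ℝ, EuclideanSpace ℝ (Fin m)) ((𝓡 3).prod 𝓘(ℝ, E3 →L[ℝ] E3 →L[ℝ] ℝ)) ∞
      (fun c : EuclideanSpace ℝ (Fin m) ↦ TotalSpace.mk' (E3 →L[ℝ] E3 →L[ℝ] ℝ)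
        (E := fun x : X ↦ TangentSpace (𝓡 3) x →L[ℝ] TangentSpace (𝓡 3) x →L[ℝ] ℝ) x (σ c x)) c₀ :=
    (hσ _).comp c₀ (contMDiffAt_id.prodMk contMDiffAt_const)
  set τ := trivializationAt E3 (TangentSpace (𝓡 3) : X → Type _) x with hτ
  have hx : x ∈ τ.baseSet := FiberBundle.mem_baseSet_trivializationAt' x
  have h1 := ((contMDiffAt_bilin_iff (IX := 𝓘(ℝ, EuclideanSpace ℝ (Fin m))) (IB := 𝓡 3)
    (V := (TangentSpace (𝓡 3) : X → Type _)) (b := fun _ : EuclideanSpace ℝ (Fin m) ↦ x)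
    (s := fun c : EuclideanSpace ℝ (Fin m) ↦ σ c x) (x₀ := c₀)).1 h0).2
  -- `h1`: `c ↦ Sᵀ (σ_c x) S` is smooth, `S = τ.symmL x` invertible with inverse `S'`
  have h2 : ContDiffAt ℝ ∞ (fun c : EuclideanSpace ℝ (Fin m) ↦
      (ContinuousLinearMap.precomp ℝ (τ.symmL ℝ x)).comp ((σ c x).comp (τ.symmL ℝ x))) c₀ :=
    contMDiffAt_iff_contDiffAt.1 h1
  set S : E3 →L[ℝ] E3 := (show E3 →L[ℝ] E3 from τ.symmL ℝ x) with hS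
  set S' : E3 →L[ℝ] E3 :=
    (show E3 →L[ℝ] E3 from (τ.continuousLinearEquivAt ℝ x hx).toContinuousLinearMap) with hS'
  have hSS' : ∀ v : E3, S (S' v) = v := by
    intro v
    show (τ.symmL ℝ x) ((τ.continuousLinearEquivAt ℝ x hx) v) = v
    rw [← Trivialization.symm_continuousLinearEquivAt_eq' τ hx]
    exact (τ.continuousLinearEquivAt ℝ x hx).symm_apply_apply v
  set Λ : (E3 →L[ℝ] E3 →L[ℝ] ℝ) →L[ℝ] (E3 →L[ℝ] E3 →L[ℝ] ℝ) :=
    (ContinuousLinearMap.compL ℝ E3 (E3 →L[ℝ] ℝ) (E3 →L[ℝ] ℝ) (ContinuousLinearMap.precomp ℝ S')).comp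
      ((ContinuousLinearMap.compL ℝ E3 E3 (E3 →L[ℝ] ℝ)).flip S') with hΛdef
  have hΛ : ∀ B : E3 →L[ℝ] E3 →L[ℝ] ℝ, Λ B = (ContinuousLinearMap.precomp ℝ S').comp (B.comp S') :=
    fun B ↦ rfl
  have h3 : ContDiffAt ℝ ∞ (fun c : EuclideanSpace ℝ (Fin m) ↦ Λ ((ContinuousLinearMap.precomp ℝ S).comp
      ((show E3 →L[ℝ] E3 →L[ℝ] ℝ from σ c x).comp S))) c₀ :=
    Λ.contDiff.contDiffAt.comp c₀ h2
  have heq : (fun c : EuclideanSpace ℝ (Fin m) ↦ Λ ((ContinuousLinearMap.precomp ℝ S).comp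
      ((show E3 →L[ℝ] E3 →L[ℝ] ℝ from σ c x).comp S))) =
      fun c ↦ (show E3 →L[ℝ] E3 →L[ℝ] ℝ from σ c x) := by
    funext c
    rw [hΛ]
    ext v w
    simp only [ContinuousLinearMap.comp_apply, ContinuousLinearMap.precomp_apply, hSS']
  rw [heq] at h3
  exact h3

/-- **The metric components of a smooth family of data are `C^∞` in the parameter**:
`c ↦ h_c(x)(u, w)` is `C^∞` on `ℝᵐ` for fixed `x, u, w`. [folklore] -/
theorem contDiff_h_inner_family {m : ℕ} {F : EuclideanSpace ℝ (Fin m) → InitialDataSet (𝓡 3) X}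
    (hF : InitialDataSet.IsSmoothDataFamily m F) (x : X) (u w : TangentSpace (𝓡 3) x) :
    ContDiff ℝ ∞ (fun c ↦ (F c).h.inner x u w) := by
  rw [contDiff_iff_contDiffAt]
  intro c₀
  have h := contDiffAt_bilin_family (σ := fun c y ↦ (F c).h.inner y) hF.1 x c₀
  exact (h.clm_apply contDiffAt_const).clm_apply contDiffAt_const

/-- **The extrinsic components of a smooth family of data are `C^∞` in the parameter**:
`c ↦ k_c(x)(u, w)` is `C^∞` on `ℝᵐ`. [folklore] -/
theorem contDiff_k_family {m : ℕ} {F : EuclideanSpace ℝ (Fin m) → InitialDataSet (𝓡 3) X}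
    (hF : InitialDataSet.IsSmoothDataFamily m F) (x : X) (u w : TangentSpace (𝓡 3) x) :
    ContDiff ℝ ∞ (fun c ↦ (F c).k x u w) := by
  rw [contDiff_iff_contDiffAt]
  intro c₀
  have h := contDiffAt_bilin_family (σ := fun c y ↦ (F c).k y) hF.2 x c₀
  exact (h.clm_apply contDiffAt_const).clm_apply contDiffAt_const

/-- **A smooth real observable with non-zero derivative at `0` separates nearby parameters.** If
`f : ℝ¹ → ℝ` is `C^∞` with `df₀(e₀) ≠ 0`, and `f` is an observable of the family `F` (`F c = F c'`
forces `f c = f c'`), then `F` is injective on a window `‖c‖ < ε` (`f` is strictly monotone near `0`).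
[folklore] -/
theorem exists_window_injective_of_observable {α : Type*} {F : EuclideanSpace ℝ (Fin 1) → α}
    (f : EuclideanSpace ℝ (Fin 1) → ℝ) (hf : ContDiff ℝ ∞ f)
    (hf0 : fderiv ℝ f 0 (EuclideanSpace.single (0 : Fin 1) (1 : ℝ)) ≠ 0)
    (hobs : ∀ c c', F c = F c' → f c = f c') :
    ∃ ε > (0 : ℝ), ∀ c c' : EuclideanSpace ℝ (Fin 1), ‖c‖ < ε → ‖c'‖ < ε → F c = F c' → c = c' := by
  set e₀ : EuclideanSpace ℝ (Fin 1) := EuclideanSpace.single (0 : Fin 1) (1 : ℝ) with he₀def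
  -- the observable along the axis `t ↦ t e₀`
  set g : ℝ → ℝ := fun t ↦ f (EuclideanSpace.single (0 : Fin 1) t) with hgdef
  have hfun : (fun t : ℝ ↦ (EuclideanSpace.single (0 : Fin 1) t : EuclideanSpace ℝ (Fin 1))) =
      fun t ↦ t • e₀ := by
    funext t
    ext i
    simp [he₀def]
  have hℓ : ∀ t : ℝ, HasDerivAt (fun t : ℝ ↦ (EuclideanSpace.single (0 : Fin 1) t : EuclideanSpace ℝ (Fin 1)))
      e₀ t := by
    intro t
    rw [hfun]
    simpa using ((hasDerivAt_id t).smul_const e₀)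
  have hg : ContDiff ℝ ∞ g := hf.comp InitialDataSet.contDiff_single_zero
  have hfd : HasFDerivAt f (fderiv ℝ f 0) (EuclideanSpace.single (0 : Fin 1) (0 : ℝ)) := by
    rw [show (EuclideanSpace.single (0 : Fin 1) (0 : ℝ) : EuclideanSpace ℝ (Fin 1)) = 0 by simp]
    exact (hf.differentiable (by simp) 0).hasFDerivAt
  have hg' : HasDerivAt g (fderiv ℝ f 0 e₀) 0 := hfd.comp_hasDerivAt (0 : ℝ) (hℓ 0)
  have hd0 : deriv g 0 ≠ 0 := by
    rw [hg'.deriv]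
    exact hf0
  have hcont : Continuous (deriv g) := hg.continuous_deriv (by simp)
  -- strict monotonicity of `g` (or `-g`) on a ball around `0`
  have key : ∃ δ > (0 : ℝ), InjOn g (Metric.ball (0 : ℝ) δ) := by
    rcases lt_or_gt_of_ne hd0 with hneg | hpos
    · have hopen : IsOpen {t : ℝ | deriv g t < 0} := isOpen_lt hcont continuous_const
      obtain ⟨δ, hδ, hball⟩ := Metric.isOpen_iff.1 hopen 0 hneg
      refine ⟨δ, hδ, (strictAntiOn_of_deriv_neg (convex_ball (0 : ℝ) δ) hg.continuous.continuousOn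
        fun t ht ↦ ?_).injOn⟩
      rw [Metric.isOpen_ball.interior_eq] at ht
      exact hball ht
    · have hopen : IsOpen {t : ℝ | 0 < deriv g t} := isOpen_lt continuous_const hcont
      obtain ⟨δ, hδ, hball⟩ := Metric.isOpen_iff.1 hopen 0 hpos
      refine ⟨δ, hδ, (strictMonoOn_of_deriv_pos (convex_ball (0 : ℝ) δ) hg.continuous.continuousOn
        fun t ht ↦ ?_).injOn⟩
      rw [Metric.isOpen_ball.interior_eq] at ht
      exact hball ht
  obtain ⟨δ, hδ, hinj⟩ := key
  refine ⟨δ, hδ, fun c c' hc hc' h ↦ ?_⟩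
  have hmem : ∀ d : EuclideanSpace ℝ (Fin 1), ‖d‖ < δ → d 0 ∈ Metric.ball (0 : ℝ) δ := by
    intro d hd
    rw [mem_ball_zero_iff, Real.norm_eq_abs, ← norm_fin_one]
    exact hd
  have hgc : ∀ d : EuclideanSpace ℝ (Fin 1), g (d 0) = f d := by
    intro d
    show f (EuclideanSpace.single (0 : Fin 1) (d 0)) = f d
    rw [single_apply_zero_fin_one]
  have hkey : c 0 = c' 0 := by
    apply hinj (hmem c hc) (hmem c' hc')
    rw [hgc, hgc]
    exact hobs c c' h
  rw [← single_apply_zero_fin_one c, ← single_apply_zero_fin_one c', hkey]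

/-- **Immersed smooth curves of data are injective on a window** — so injectivity of a witness is
never owed by an engine: some scalar component `c ↦ h_c(x)(u,w)` or `c ↦ k_c(x)(u,w)` is `C^∞`
(`contDiff_h_inner_family`) with non-zero derivative at `0`, hence strictly monotone near `0`.
[folklore] -/
theorem exists_window_injective {F : EuclideanSpace ℝ (Fin 1) → InitialDataSet (𝓡 3) X}
    (hF : InitialDataSet.IsSmoothDataFamily 1 F) (himm : InitialDataSet.IsImmersedAtZero 1 F) :
    ∃ ε > (0 : ℝ), ∀ c c' : EuclideanSpace ℝ (Fin 1), ‖c‖ < ε → ‖c'‖ < ε → F c = F c' → c = c' := by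
  have he₀ : (EuclideanSpace.single (0 : Fin 1) (1 : ℝ) : EuclideanSpace ℝ (Fin 1)) ≠ 0 := by
    rw [← norm_ne_zero_iff]
    simp
  obtain ⟨x, u, w, huw⟩ := himm _ he₀
  rcases huw with h | h
  · exact exists_window_injective_of_observable (fun c ↦ (F c).h.inner x u w)
      (contDiff_h_inner_family hF x u w) h (fun c c' hcc' ↦ by rw [hcc'])
  · exact exists_window_injective_of_observable (fun c ↦ (F c).k x u w)
      (contDiff_k_family hF x u w) h (fun c c' hcc' ↦ by rw [hcc'])

/-- **Immersion along the slide axis from agreement of the slide with an immersed curve.** If `H` is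
a jointly smooth two-parameter family whose slide `c ↦ H (c, 0)` agrees with the immersed curve `F` on
a window, then `H` is immersed along the slide axis (the scalar components of `H` are `C^∞`,
`contDiff_h_inner_family`, so the derivative of `c ↦ H (c, 0)` at `0` is that of `H` along the axis).
[folklore] -/
theorem slideImmersed_of_eqOn {H : EuclideanSpace ℝ (Fin 2) → InitialDataSet (𝓡 3) X}
    (hH : InitialDataSet.IsSmoothDataFamily 2 H) {F : EuclideanSpace ℝ (Fin 1) → InitialDataSet (𝓡 3) X}
    (himm : InitialDataSet.IsImmersedAtZero 1 F) {ε : ℝ} (hε : 0 < ε)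
    (heq : ∀ c : EuclideanSpace ℝ (Fin 1), ‖c‖ < ε → H (slideAxisL c) = F c) : SlideImmersed H := by
  intro v hv
  obtain ⟨x, u, w, huw⟩ := himm v hv
  refine ⟨x, u, w, ?_⟩
  have key : ∀ (G : EuclideanSpace ℝ (Fin 2) → ℝ) (f : EuclideanSpace ℝ (Fin 1) → ℝ), ContDiff ℝ ∞ G →
      (∀ c : EuclideanSpace ℝ (Fin 1), ‖c‖ < ε → G (slideAxisL c) = f c) → fderiv ℝ f 0 v ≠ 0 →
        fderiv ℝ G 0 (slideAxisL v) ≠ 0 := by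
    intro G f hG hGf hf
    have hev : (fun c ↦ G (slideAxisL c)) =ᶠ[𝓝 0] f := by
      filter_upwards [Metric.ball_mem_nhds (0 : EuclideanSpace ℝ (Fin 1)) hε] with c hc
      exact hGf c (mem_ball_zero_iff.1 hc)
    have h1 : fderiv ℝ f 0 = fderiv ℝ (fun c ↦ G (slideAxisL c)) 0 := hev.fderiv_eq.symm
    have hGd : DifferentiableAt ℝ G (slideAxisL 0) := (hG.differentiable (by simp)) _
    have h2 : fderiv ℝ (fun c ↦ G (slideAxisL c)) 0 = (fderiv ℝ G (slideAxisL 0)).comp (fderiv ℝ slideAxisL 0) :=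
      fderiv_comp 0 hGd slideAxisL.differentiableAt
    rw [h1, h2] at hf
    simpa using hf
  rcases huw with h | h
  · exact Or.inl (key (fun p ↦ (H p).h.inner x u w) (fun c ↦ (F c).h.inner x u w)
      (contDiff_h_inner_family hH x u w) (fun c hc ↦ by rw [heq c hc]) h)
  · exact Or.inr (key (fun p ↦ (H p).k x u w) (fun c ↦ (F c).k x u w)
      (contDiff_k_family hH x u w) (fun c hc ↦ by rw [heq c hc]) h)

/-- **THE HOST: composition of tame Christodoulou genericities along curves, SLIDE-AND-KICK form.**
Let every datum of `𝓓` have a sole, strongly asymptotically flat end, let `Q` be tame-generic in `𝓓`,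
and suppose that along every tame curve `F` of `𝓓`-data with `Q`-members off `0` (`F` told immersed-
injective, or constant) whose base datum FAILS `P`, one can hand: an end `e'`, a two-parameter family
`H` through the base (`H 0 = F 0`) IMMERSED ALONG THE SLIDE AXIS, and a window `ε > 0` on which the
parabola `c ↦ H (c, c²)` is tame on `e'`, takes values in `𝓓`, and satisfies `P` off `c = 0`. Then `P` is
tame-generic in `𝓓` (codimension `1`): the parabola is the witness — tame (given), immersed
(`isImmersedAtZero_parab`), injective on a window (`exists_window_injective`), and window control
suffices (`InitialDataSet.isTameChristodoulouGeneric_of_localWindow`). [folklore] -/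
theorem isTameChristodoulouGeneric_of_slideKick {𝓓 : Set (InitialDataSet (𝓡 3) X)}
    {Q P : InitialDataSet (𝓡 3) X → Prop}
    (h𝓓 : ∀ d ∈ 𝓓, ∃ e : AFEnd X, e.IsSoleEnd ∧ ∃ M : ℝ, e.IsStronglyAsymptoticallyFlatDR d M)
    (hQ : InitialDataSet.IsTameChristodoulouGeneric 𝓓 Q 1)
    (hsk : ∀ (e : AFEnd X) (F : EuclideanSpace ℝ (Fin 1) → InitialDataSet (𝓡 3) X),
      InitialDataSet.IsTameDataFamily e 1 F →
        ((InitialDataSet.IsImmersedAtZero 1 F ∧ Injective F) ∨ ∀ c, F c = F 0) →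
        (∀ c, F c ∈ 𝓓) → (∀ c ≠ 0, Q (F c)) → ¬ P (F 0) →
          ∃ (e' : AFEnd X) (H : EuclideanSpace ℝ (Fin 2) → InitialDataSet (𝓡 3) X) (ε : ℝ),
            0 < ε ∧ InitialDataSet.IsTameDataFamily e' 1 (fun c ↦ H (parab c)) ∧ H 0 = F 0 ∧
              SlideImmersed H ∧ (∀ c : EuclideanSpace ℝ (Fin 1), ‖c‖ < ε → H (parab c) ∈ 𝓓) ∧
              ∀ c : EuclideanSpace ℝ (Fin 1), c ≠ 0 → ‖c‖ < ε → P (H (parab c))) :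
    InitialDataSet.IsTameChristodoulouGeneric 𝓓 P 1 := by
  refine InitialDataSet.isTameChristodoulouGeneric_of_localWindow fun d hd𝓓 hdP ↦ ?_
  -- the tame base curve through `d`: constant if `Q d`, the `Q`-witness otherwise
  have base : ∃ (e : AFEnd X) (F : EuclideanSpace ℝ (Fin 1) → InitialDataSet (𝓡 3) X),
      InitialDataSet.IsTameDataFamily e 1 F ∧
        ((InitialDataSet.IsImmersedAtZero 1 F ∧ Injective F) ∨ ∀ c, F c = F 0) ∧
        F 0 = d ∧ (∀ c, F c ∈ 𝓓) ∧ ∀ c ≠ 0, Q (F c) := by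
    by_cases hQd : Q d
    · obtain ⟨e, hsole, M, hSAF⟩ := h𝓓 d hd𝓓
      exact ⟨e, fun _ ↦ d, InitialDataSet.isTameDataFamily_const hsole 1 hSAF, Or.inr fun _ ↦ rfl, rfl,
        fun _ ↦ hd𝓓, fun _ _ ↦ hQd⟩
    · obtain ⟨e, F, hF, himmF, h0, hinjF, h𝓓F, hE⟩ := hQ d ⟨hd𝓓, hQd⟩
      refine ⟨e, F, hF, Or.inl ⟨himmF, hinjF⟩, h0, h𝓓F, fun c hc ↦ ?_⟩
      by_contra hQc
      exact hE c hc ⟨h𝓓F c, hQc⟩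
  obtain ⟨e, F, hF, hFdich, hF0, hF𝓓, hFQ⟩ := base
  obtain ⟨e', H, ε, hε, hHt, hH0, hslide, h𝓓H, hPH⟩ := hsk e F hF hFdich hF𝓓 hFQ (by rwa [hF0])
  -- the parabola witness
  have himm : InitialDataSet.IsImmersedAtZero 1 (fun c ↦ H (parab c)) := isImmersedAtZero_parab hslide
  obtain ⟨ε₁, hε₁, hinj⟩ := exists_window_injective hHt.isSmoothDataFamily himm
  refine ⟨e', min ε ε₁, fun c ↦ H (parab c), lt_min hε hε₁, hHt, himm, ?_, ?_, ?_, ?_⟩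
  · show H (parab 0) = d
    rw [parab_zero, hH0, hF0]
  · intro c c' hc hc' h
    exact hinj c c' (hc.trans_le (min_le_right _ _)) (hc'.trans_le (min_le_right _ _)) h
  · intro c hc
    exact h𝓓H c (hc.trans_le (min_le_left _ _))
  · intro c hc hcε
    exact hPH c hc (hcε.trans_le (min_le_left _ _))

end Host

/-! ## §3 Registered stubs (the only `sorry`s of the file) -/

/-- **Stub S1 `stub_lateLeafTransfer` (geometry; the first landable stub) — THE SUMMIT MATRIX DESCENDS
FROM A LENS LEAF.** Let `𝒟` be a maximal vacuum Cauchy development of the admissible datum `d`, and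
`(j, ν')` a lens leaf of `𝒟` carrying `d'` (`IsLensLeaf`: a late Cauchy leaf agreeing with `(ι, ν)` off a
compact set). If `d'` satisfies the summit matrix (MGHD exists; every MGHD of `d'` has complete `𝓘⁺` in
sojourn form and an honest `C²` sub-extremal final-state decomposition of `exteriorOf`, rays staying in its
closure, exhaustive honest charts, future-oriented), then so does `d`. Content: `(M, g, τ, j, ν')` is an
MGHD of `d'` (mutual embedding with `MGHD(d')` + one-jet rigidity — `MGHDUniqueness`, no Choquet-Bruhat–
Geroch needed); far rays from the two leaves coincide (sojourn clauses transfer with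
`B₀ := ι⁻¹ J⁻(j B₀')`); `exteriorOf` grows by the compact lens region only, rays from `ι p`, `p` in the
lens, join `j`-rays after crossing the leaf (`J⁻` of the closure of a chronological past); exhaustion after
trimming `τ₀` beyond the chart times of the compact `j(K)`. Ringström 2009, Ch. 16; O'Neill 1983, Ch. 14;
Sbierski 2016, Thm. 2.6. [cite: Ringstrom2009, Thm. 16.6] -/
theorem stub_lateLeafTransfer :
    ∀ (X : Type) [TopologicalSpace X] [ChartedSpace E3 X] [IsManifold (𝓡 3) ∞ X] [T2Space X]
      [SecondCountableTopology X] [ConnectedSpace X],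
      ∀ d ∈ admissibleVacuumData X, ∀ 𝒟 : VacuumCauchyDevelopment d, 𝒟.IsMaximal →
        ∀ (d' : InitialDataSet (𝓡 3) X) (j : X → 𝒟.carrier) (ν' : NormalField (𝓡 4) j),
          IsLensLeaf 𝒟 d' j ν' → SummitPropertyAt X d' → SummitPropertyAt X d := by
  sorry

/-- **Stub S2 `stub_kickTransportSlide` (PDE folklore + MGHD existence) — BACKWARD TRANSPORT OF A LATE
COMPACT KICK FAMILY ALONG THE BREATHING SLIDE.** Let `𝒟` be a maximal vacuum Cauchy development of the
admissible datum `d`, `(j, ν')` a lens leaf of `𝒟` carrying `d'`, and `G : ℝ¹ → data` a jointly smooth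
family of vacuum data through `d'` agreeing with `d'` off the compact `K`, whose small positive members
have maximal developments. Then there are an end `e'`, a two-parameter family `H : ℝ² → data` with
`H 0 = d`, immersed along the slide axis, and a window `ε > 0` such that the parabola `c ↦ H (c, c²)` is
tame on `e'` and admissible on the window, and for every `0 < ‖c‖ < ε` the member `H (c, c²)` has a
MAXIMAL vacuum Cauchy development carrying a lens leaf with the kicked data `G (c²)`. Intended proof:
`H (c, s) := Φ_c^* Back[G s]` — `Φ_c` the breathing diffeomorphisms of `d` (`TameBreathingCurve`: tame,
immersed, injective, admissible members, supported in a far ball chosen disjoint from the `t = 0`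
footprint `ι⁻¹ J⁻(j K)` of the kick), `Back` = time-reversed Cauchy stability for the vacuum equations on
the compact region `J⁻(j K) ∩ J⁺(ι X)` with smooth dependence on `s`, exact agreement off it (domain of
dependence); the transported leaf is Cauchy in `MGHD(G s)` (squeeze between `j X` and the backward slab)
and that development is maximal for the transported datum by Choquet-Bruhat–Geroch (item 9937 / named fact
`choquetBruhat_geroch_exists_mghd_cauchy`); tameness of the parabola by
`isTameDataFamily_restrict_of_agree_off_compact`; admissibility by agreement with `Φ_c^* d` off a compact
set. Ringström 2009, Chs. 15–16; Hawking–Ellis 1973, §7.5; Choquet-Bruhat–Geroch 1969, Thm. 3.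
[cite: Ringstrom2009, Thm. 16.6] [cite: ChoquetBruhatGeroch1969CMP, Thm. 3] -/
theorem stub_kickTransportSlide :
    ∀ (X : Type) [TopologicalSpace X] [ChartedSpace E3 X] [IsManifold (𝓡 3) ∞ X] [T2Space X]
      [SecondCountableTopology X] [ConnectedSpace X],
      ∀ d ∈ admissibleVacuumData X, ∀ 𝒟 : VacuumCauchyDevelopment d, 𝒟.IsMaximal →
        ∀ (d' : InitialDataSet (𝓡 3) X) (j : X → 𝒟.carrier) (ν' : NormalField (𝓡 4) j),
          IsLensLeaf 𝒟 d' j ν' →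
          ∀ (K : Set X) (G : EuclideanSpace ℝ (Fin 1) → InitialDataSet (𝓡 3) X),
            IsCompact K → InitialDataSet.IsSmoothDataFamily 1 G → G 0 = d' →
            (∀ s, ∀ x ∉ K, (G s).h.inner x = d'.h.inner x ∧ (G s).k x = d'.k x) →
            (∀ s, ∀ [(G s).metric.HasLeviCivita], (G s).IsVacuumConstraintSolution) →
            ∀ ε₀ > (0 : ℝ),
              (∀ s : EuclideanSpace ℝ (Fin 1), ‖s‖ < ε₀ → 0 < s 0 →
                ∃ 𝒟s : VacuumCauchyDevelopment (G s), 𝒟s.IsMaximal) →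
              ∃ (e' : AFEnd X) (H : EuclideanSpace ℝ (Fin 2) → InitialDataSet (𝓡 3) X) (ε : ℝ),
                0 < ε ∧ InitialDataSet.IsTameDataFamily e' 1 (fun c ↦ H (parab c)) ∧ H 0 = d ∧
                SlideImmersed H ∧
                (∀ c : EuclideanSpace ℝ (Fin 1), ‖c‖ < ε → H (parab c) ∈ admissibleVacuumData X) ∧
                ∀ c : EuclideanSpace ℝ (Fin 1), c ≠ 0 → ‖c‖ < ε →
                  ∃ 𝒟c : VacuumCauchyDevelopment (H (parab c)), 𝒟c.IsMaximal ∧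
                    ∃ (j' : X → 𝒟c.carrier) (ν'' : NormalField (𝓡 4) j'),
                      IsLensLeaf 𝒟c (G (EuclideanSpace.single (0 : Fin 1) (c 0 * c 0))) j' ν'' := by
  sorry

/-- **Stub S3 `stub_censoredLateKick` (dynamics; C⁺ absolute: ONE-SIDED LATE LOCAL CONTROLLABILITY OF
CENSORED DEVELOPMENTS).** A censored admissible datum `d` (an MGHD exists, every MGHD has complete `𝓘⁺`)
which FAILS the summit matrix admits: a maximal development `𝒟`, a lens leaf `(j, ν')` of `𝒟` carrying
`d'`, a compact `K ⊆ X` and a jointly smooth family `G : ℝ¹ → data` through `d'`, agreeing with `d'` off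
`K`, of solutions of the vacuum constraints, such that for all small POSITIVE parameters `0 < s < ε` the
kicked late datum `G s` satisfies the summit matrix (as a datum: its MGHD exists, has complete `𝓘⁺`, and
settles honestly in `C²` to finitely many sub-extremal Kerr holes plus radiation). The kick is designed
where the geometry is known: on a leaf through the late, quiet near zones of `𝒟` (chosen by the prover,
who holds `𝒟` classically); extremal members are un-parked at SECOND order (compactly supported vacuum
kicks are charge-neutral to first order; positivity of the absorbed flux `δ²M − Ω_H δ²J` for kicks with
horizon shear, Sorce–Wald sign) and captured from the black-hole side; one-sidedness is what the tame
notion permits (`IsImmersedAtZero` is a jet condition — the card's loophole). Open-problem sized; NOT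
summit-implied by soft logic (summit witnesses are global tame curves at `t = 0`, not compact late kicks);
summit-hard on the non-quiet stratum (censored worlds never Kerr-close: breathers, eternal binaries,
non-Kerr stationary ends — none known). Angelopoulos–Kehle–Unger 2026 (threshold, symmetry);
Kehle–Unger 2025; Dafermos–Luk 2017, §1.2.1; Sorce–Wald 2017.
[cite: DafermosLuk2017, §1.2.1 p. 8] [cite: AngelopoulosKehleUnger2026, Thm 1] -/
theorem stub_censoredLateKick :
    ∀ (X : Type) [TopologicalSpace X] [ChartedSpace E3 X] [IsManifold (𝓡 3) ∞ X] [T2Space X]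
      [SecondCountableTopology X] [ConnectedSpace X],
      ∀ d ∈ admissibleVacuumData X, CensoredAt X d → ¬ SummitPropertyAt X d →
        ∃ 𝒟 : VacuumCauchyDevelopment d, 𝒟.IsMaximal ∧
          ∃ (d' : InitialDataSet (𝓡 3) X) (j : X → 𝒟.carrier) (ν' : NormalField (𝓡 4) j),
            IsLensLeaf 𝒟 d' j ν' ∧
            ∃ (K : Set X) (G : EuclideanSpace ℝ (Fin 1) → InitialDataSet (𝓡 3) X),
              IsCompact K ∧ InitialDataSet.IsSmoothDataFamily 1 G ∧ G 0 = d' ∧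
              (∀ s, ∀ x ∉ K, (G s).h.inner x = d'.h.inner x ∧ (G s).k x = d'.k x) ∧
              (∀ s, ∀ [(G s).metric.HasLeviCivita], (G s).IsVacuumConstraintSolution) ∧
              ∃ ε > (0 : ℝ), ∀ s : EuclideanSpace ℝ (Fin 1), ‖s‖ < ε → 0 < s 0 →
                SummitPropertyAt X (G s) := by
  sorry

/-- **Stub S4 `stub_nakedBaseKick` (dynamics; C⁺ relative — HARDEST): KICKS ALONG THE CENSORSHIP
WITNESS THROUGH A NAKED DATUM.** Let `F` be a tame, immersed, injective curve of admissible data on the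
end `e` whose members off `0` are censored while the base `F 0` is NOT (the only curves on which the
composition calls this stub: the witnesses `h₃` hands through data forming naked singularities). Then
there are an end `e'`, a jointly smooth two-parameter family `H : ℝ² → data` whose slide agrees with `F`
on a window (`H (c, 0) = F c`, `‖c‖ < ε`), whose parabola `c ↦ H (c, c²)` is tame on `e'` and admissible on
the window, and such that every parabola member off `0` has a maximal development carrying a lens leaf
whose data satisfy the summit matrix. Intended mechanism: fibrewise late compact kicks on the censored
members `F c`, `c ≠ 0` (S3 with parameters, on leaves through the quiet zones of `MGHD(F c)`), blended
smoothly in `c` and FLAT at `c = 0` (no kick of the naked base is ever needed: only the parabola is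
constrained), amplitudes reparametrised so that the parabola stays tame although the `t = 0` footprints
of the kicks may exhaust `X` as `c → 0`. Open-problem sized: a parametric, whole-family version of the
dynamics near a naked limit (the route's own why-it-might-fail for this rank); quiet times `T(c) → ∞`
force the kick amplitude below every weight of the footprint. Christodoulou 1999 (instability of naked
singularities, symmetry); Dafermos–Luk 2017, §1.2.1; Rodnianski–Shlapentokh-Rothman 2019 (vacuum naked
singularities, non-generic). [cite: DafermosLuk2017, §1.2.1 p. 8] [cite: Christodoulou1999, p. A24] -/
theorem stub_nakedBaseKick :
    ∀ (X : Type) [TopologicalSpace X] [ChartedSpace E3 X] [IsManifold (𝓡 3) ∞ X] [T2Space X]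
      [SecondCountableTopology X] [ConnectedSpace X],
      ∀ (e : AFEnd X) (F : EuclideanSpace ℝ (Fin 1) → InitialDataSet (𝓡 3) X),
        InitialDataSet.IsTameDataFamily e 1 F → InitialDataSet.IsImmersedAtZero 1 F → Injective F →
        (∀ c, F c ∈ admissibleVacuumData X) → (∀ c ≠ 0, CensoredAt X (F c)) → ¬ CensoredAt X (F 0) →
          ∃ (e' : AFEnd X) (H : EuclideanSpace ℝ (Fin 2) → InitialDataSet (𝓡 3) X) (ε : ℝ),
            0 < ε ∧ InitialDataSet.IsSmoothDataFamily 2 H ∧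
            InitialDataSet.IsTameDataFamily e' 1 (fun c ↦ H (parab c)) ∧
            (∀ c : EuclideanSpace ℝ (Fin 1), ‖c‖ < ε → H (slideAxisL c) = F c) ∧
            (∀ c : EuclideanSpace ℝ (Fin 1), ‖c‖ < ε → H (parab c) ∈ admissibleVacuumData X) ∧
            ∀ c : EuclideanSpace ℝ (Fin 1), c ≠ 0 → ‖c‖ < ε →
              ∃ 𝒟c : VacuumCauchyDevelopment (H (parab c)), 𝒟c.IsMaximal ∧
                ∃ (d'' : InitialDataSet (𝓡 3) X) (j : X → 𝒟c.carrier) (ν' : NormalField (𝓡 4) j),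
                  IsLensLeaf 𝒟c d'' j ν' ∧ SummitPropertyAt X d'' := by
  sorry

/-! ## §4 The composition (sorry-free): the summit from `h₃` and the four stubs, hence the crux BY NAME -/

section Composition

variable {X : Type} [TopologicalSpace X] [ChartedSpace E3 X] [IsManifold (𝓡 3) ∞ X] [T2Space X]
  [SecondCountableTopology X] [ConnectedSpace X]

/-- **SLIDE-AND-KICK FAMILIES ALONG CENSORED CURVES** (the host's hypothesis, discharged from the stubs):
along every tame admissible curve with censored members off `0` whose base fails the summit matrix —
censored base: late kick family (S3), transported to `t = 0` along the breathing slide (S2), parabola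
members certified through their lens leaves (S1); naked base: the curve is immersed-injective and S4
serves the family, S1 certifies. -/
theorem slideKick_along_censored (e : AFEnd X) (F : EuclideanSpace ℝ (Fin 1) → InitialDataSet (𝓡 3) X)
    (hF : InitialDataSet.IsTameDataFamily e 1 F)
    (hdich : (InitialDataSet.IsImmersedAtZero 1 F ∧ Injective F) ∨ ∀ c, F c = F 0)
    (hadm : ∀ c, F c ∈ admissibleVacuumData X) (hQ : ∀ c ≠ 0, CensoredAt X (F c))
    (hP : ¬ SummitPropertyAt X (F 0)) :
    ∃ (e' : AFEnd X) (H : EuclideanSpace ℝ (Fin 2) → InitialDataSet (𝓡 3) X) (ε : ℝ),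
      0 < ε ∧ InitialDataSet.IsTameDataFamily e' 1 (fun c ↦ H (parab c)) ∧ H 0 = F 0 ∧
        SlideImmersed H ∧ (∀ c : EuclideanSpace ℝ (Fin 1), ‖c‖ < ε → H (parab c) ∈ admissibleVacuumData X) ∧
        ∀ c : EuclideanSpace ℝ (Fin 1), c ≠ 0 → ‖c‖ < ε → SummitPropertyAt X (H (parab c)) := by
  by_cases hc : CensoredAt X (F 0)
  · -- censored base: S3 (late kick) ∘ S2 (transport along breathing) ∘ S1 (descent)
    obtain ⟨𝒟, hmax, d', j, ν', hleaf, K, G, hK, hG, hG0, hagree, hvac, ε, hε, hgood⟩ :=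
      stub_censoredLateKick X (F 0) (hadm 0) hc hP
    obtain ⟨e', H, ε', hε', hHt, hH0, hslide, hadmH, hleafH⟩ :=
      stub_kickTransportSlide X (F 0) (hadm 0) 𝒟 hmax d' j ν' hleaf K G hK hG hG0 hagree hvac ε hε
        (fun s hs hs0 ↦ (hgood s hs hs0).1)
    refine ⟨e', H, min (min ε ε') 1, lt_min (lt_min hε hε') one_pos, hHt, hH0, hslide,
      fun c hcn ↦ hadmH c (hcn.trans_le ((min_le_left _ _).trans (min_le_right _ _))), fun c hc0 hcn ↦ ?_⟩
    have hcε : ‖c‖ < ε := hcn.trans_le ((min_le_left _ _).trans (min_le_left _ _))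
    have hcε' : ‖c‖ < ε' := hcn.trans_le ((min_le_left _ _).trans (min_le_right _ _))
    have hc1 : ‖c‖ < 1 := hcn.trans_le (min_le_right _ _)
    obtain ⟨𝒟c, hmaxc, j', ν'', hleaf'⟩ := hleafH c hc0 hcε'
    set s : EuclideanSpace ℝ (Fin 1) := EuclideanSpace.single (0 : Fin 1) (c 0 * c 0) with hsdef
    have hc0' : c 0 ≠ 0 := apply_zero_ne_zero hc0
    have habs : |c 0| < 1 := by rw [← norm_fin_one]; exact hc1
    have habsε : |c 0| < ε := by rw [← norm_fin_one]; exact hcε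
    have hs : ‖s‖ < ε := by
      have hns : ‖s‖ = |c 0 * c 0| := by
        rw [hsdef]
        simp
      rw [hns, abs_mul]
      have h0 : 0 < |c 0| := abs_pos.2 hc0'
      calc |c 0| * |c 0| < 1 * |c 0| := by gcongr
        _ = |c 0| := one_mul _
        _ < ε := habsε
    have hs0 : 0 < s 0 := by
      rw [hsdef]
      simpa using mul_self_pos.2 hc0'
    exact stub_lateLeafTransfer X (H (parab c)) (hadmH c hcε') 𝒟c hmaxc (G s) j' ν'' hleaf' (hgood s hs hs0)
  · -- naked base: the curve is not constant (its members off `0` are censored), hence immersed-injective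
    have hii : InitialDataSet.IsImmersedAtZero 1 F ∧ Injective F := by
      refine hdich.resolve_right fun hconst ↦ hc ?_
      have hne : (EuclideanSpace.single (0 : Fin 1) (1 : ℝ) : EuclideanSpace ℝ (Fin 1)) ≠ 0 := by
        rw [← norm_ne_zero_iff]
        simp
      rw [← hconst (EuclideanSpace.single (0 : Fin 1) (1 : ℝ))]
      exact hQ _ hne
    obtain ⟨e', H, ε, hε, hHs, hHt, hslideEq, hadmH, hleafH⟩ :=
      stub_nakedBaseKick X e F hF hii.1 hii.2 hadm hQ hc
    refine ⟨e', H, ε, hε, hHt, ?_, slideImmersed_of_eqOn hHs hii.1 hε hslideEq, hadmH, fun c hc0 hcn ↦ ?_⟩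
    · have h := hslideEq 0 (by simpa using hε)
      simpa using h
    · obtain ⟨𝒟c, hmaxc, d'', j, ν', hleaf, hgood⟩ := hleafH c hc0 hcn
      exact stub_lateLeafTransfer X (H (parab c)) (hadmH c hcn) 𝒟c hmaxc d'' j ν' hleaf hgood

/-- **The re-typed summit from `h₃ = WeakCosmicCensorshipTame` and the four stubs.** -/
theorem finalStateConjecture_of_stubs (hW : WeakCosmicCensorshipTame) : _root_.FinalStateConjecture := by
  intro X _ _ _ _ _ _
  have h𝓓 : ∀ d ∈ admissibleVacuumData X,
      ∃ e : AFEnd X, e.IsSoleEnd ∧ ∃ M : ℝ, e.IsStronglyAsymptoticallyFlatDR d M :=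
    fun d hd ↦ exists_isSoleEnd_of_mem_admissibleVacuumData hd
  exact isTameChristodoulouGeneric_of_slideKick (Q := CensoredAt X) (P := SummitPropertyAt X) h𝓓 (hW X)
    (fun e F hF hdich hadm hQ hP ↦ slideKick_along_censored e F hF hdich hadm hQ hP)

end Composition

/-- **THE CRUX BY NAME (exactly the four registered stubs).** `CaptureSufficesTame` — its first two
hypotheses (the Cauchy-typed captures) introduced and dropped: idle under the tame re-typing (Disproof.lean
§0–§1: modulo the captures the crux is `WCCTame ↔ FSC`; no `_false_without_` theorem exists), the card
paying this price knowingly — its kicks are late and compact and never read a Cauchy-leaf basin; the third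
hypothesis is the source of the censored base curves along which the slide-and-kick families are served. -/
theorem CaptureSufficesTame_of : CaptureSufficesTame :=
  fun _ _ hW ↦ finalStateConjecture_of_stubs hW

/-- The same, in arrow form over the stub statements' consumers: the route's summit follows from `h₃`
alone once the stubs are theorems (measure: the line proves the bare form `WCCTame → FSC`). -/
theorem finalStateConjecture_of_censorship : WeakCosmicCensorshipTame → _root_.FinalStateConjecture :=
  finalStateConjecture_of_stubs

end Summit.FinalStateConjecture.FinalStateConjecture.Cruxes.CaptureSufficesTame.SlideAndKick

end
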